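import Literature.Probability.RandomPlanarGeometry.HexSAWBridgeDecay
import HarnessLib

/-!
# Crux `HexConjecture` (stmt-CriticalPhenomena-0808), line `root-locality-replaces-loewner`:
Glazman–Manolescu's left-exiting glued arcs, reflected into the right floor window

Landing target:
`Summits/CriticalPhenomena/SAWScalingLimit/Theorems/SAWDevelopingMapHexConjectureArcsInWindow.lean`
(`--supports stmt-CriticalPhenomena-0808`).

Glazman–Manolescu's gluing inequality (`HV.key_ineq`, §4.1 of GlazmanManolescu2019) bounds the
cube `triDl (4L)³` of the triangle tail by the `x_c`-mass of the arcs of the Duminil-Copin–Smirnov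
trapezoid `S_{T',L''}` that leave through the floor (`α`-darts) in the columns `[-9L-1, -L-1]`, to
the LEFT of the starting mid-edge `a` (`HV.arcsIn T' L'' L`).  The line's window two-point lower
bound is phrased with the floor window to the RIGHT of `a` and with the "coded floor-arch sums"
(the `∨`-filters on `finalDart`) of `…HexConjectureArchTailSummed.lean`.  This file supplies the
bookkeeping step (registered stub `stub_arcsIn_sum_le_windowCoded`):

`Σ_{Q ∈ arcsIn (9L+1) (9L+1) L} x_c^{ℓ(Q)} ≤ Σ_{d = L+1}^{9L+1} Σ_{P ⊂ S_{9L+1,9L+1} : a → floor mid-edge at abscissa d} x_c^{ℓ(P)}`.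

Proof: the reflection `HV.reflT` of `ℍ` in the vertical axis of `a` (a graph automorphism fixing
`w` and `O`) preserves `V(S_{T,L})` (`arcsWin_reflT_mem_stripV_iff`), transports mid-edge walks
(`IsMidWalk.map_iso`) preserving the length, and sends the `α`-dart at abscissa `c` to the `α`-dart
at abscissa `-c` (`arcsWin_reflT_dart_of_isAlphaDart`); `Q ↦ Q.map reflT` is injective, so the
left sum is at most the sum over the (disjoint, `arcsWin_pairwiseDisjoint_coded`) union of the coded
classes at `d ∈ [L+1, 9L+1]`, which is the right-hand side (`Finset.sum_biUnion`).  This is the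
reflection bookkeeping of `HV.triDl_eq_triDr` ("by vertical symmetry", §4.1) for the strip.
-/

noncomputable section

open scoped BigOperators Classical
open Finset
open Literature.Probability.RandomPlanarGeometry Literature.Probability.RandomPlanarGeometry.SAW
  Literature.Probability.RandomPlanarGeometry.SAW.HV

namespace Summit.CriticalPhenomena.SAWScalingLimit.Theorems.HexConjecture.RootLocality

/-- **The reflection `reflT` preserves the trapezoid `S_{T,L}`** ("the domain is symmetric under
the reflection fixing `a`"). [cite: GlazmanManolescu2019, §4.1 ("by vertical symmetry")] -/
theorem arcsWin_reflT_mem_stripV_iff {T L : ℕ} (v : HV) :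
    reflT v ∈ stripV T L ↔ v ∈ stripV T L := by
  obtain ⟨a, b, c⟩ := v
  rw [mem_stripV_iff, mem_stripV_iff]
  cases c <;> simp [bit] <;> omega

/-- **The reflection sends the floor exit at abscissa `c` to the floor exit at abscissa `-c`.**
[cite: GlazmanManolescu2019, §4.1 ("by vertical symmetry")] -/
theorem arcsWin_reflT_dart_of_isAlphaDart {e : HV × HV} (h : IsAlphaDart e) :
    (reflT e.1, reflT e.2) = ((-e.1.1, 0, false), (-e.1.1, -1, true)) := by
  obtain ⟨⟨a, b, c⟩, u⟩ := e
  obtain ⟨h1, h2, h3⟩ := h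
  dsimp only at h1 h2 h3
  subst h1 h2 h3
  refine Prod.ext (Prod.ext ?_ (Prod.ext rfl rfl)) (Prod.ext ?_ (Prod.ext rfl rfl))
  · show -a - 0 - bit (a, 0, false) = -a
    rw [bit_false]; omega
  · show -a - (-1) - bit (a, -1, true) = -a
    rw [bit_true]; omega

/-- The coded floor-arch classes (walks ending on the floor mid-edge at abscissa `d`, in either
orientation) at distinct abscissae are disjoint. [folklore] -/
theorem arcsWin_pairwiseDisjoint_coded (V : Finset HV) (s : Set ℤ) :
    s.PairwiseDisjoint (fun d => (midWalks V).filter (fun P =>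
      finalDart P = ((d, 0, false), (d, -1, true)) ∨ finalDart P = ((d, -1, true), (d, 0, false)))) := by
  intro d _ d' _ hne
  refine Finset.disjoint_filter.2 fun P _ h h' => hne ?_
  rcases h with h | h <;> rcases h' with h' | h' <;>
    exact congrArg (fun q : HV × HV => q.1.1) (h.symm.trans h')

/-- Summing the coded floor-arch sums over a set of abscissae is summing over the disjoint union of
the coded classes. [folklore] -/
theorem arcsWin_sum_coded_eq_sum_biUnion (V : Finset HV) (s : Finset ℤ) (f : List HV → ℝ) :
    ∑ d ∈ s, ∑ P ∈ (midWalks V).filter (fun P =>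
        finalDart P = ((d, 0, false), (d, -1, true)) ∨ finalDart P = ((d, -1, true), (d, 0, false))),
        f P =
      ∑ P ∈ s.biUnion (fun d => (midWalks V).filter (fun P =>
        finalDart P = ((d, 0, false), (d, -1, true)) ∨ finalDart P = ((d, -1, true), (d, 0, false)))),
        f P :=
  (sum_biUnion (arcsWin_pairwiseDisjoint_coded V s)).symm

/-- **Glazman–Manolescu's left-exiting glued arcs, reflected into the right floor window and bounded
by the coded floor-arch sums**: for every `L`,
`Σ_{Q ∈ arcsIn (9L+1) (9L+1) L} x_c^{ℓ(Q)} ≤ Σ_{d = L+1}^{9L+1} (coded arch mass of S_{9L+1,9L+1} at d)`.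
The reflection `reflT` maps the arcs exiting in the columns `[-9L-1, -L-1]` injectively and
length-preservingly to walks of the same strip exiting through the floor mid-edge at abscissa
`d ∈ [L+1, 9L+1]`. [cite: GlazmanManolescu2019, §4.1 ("by vertical symmetry"; proof of Proposition 1.1)] -/
theorem stub_arcsIn_sum_le_windowCoded : ∀ (L : ℕ), ∑ Q ∈ Literature.Probability.RandomPlanarGeometry.SAW.HV.arcsIn (9 * L + 1) (9 * L + 1) L, Literature.Probability.RandomPlanarGeometry.SAW.hexCriticalFugacity ^ Literature.Probability.RandomPlanarGeometry.SAW.HV.mwLen Q ≤ ∑ d ∈ Finset.Icc ((L : ℤ) + 1) (9 * (L : ℤ) + 1), ∑ P ∈ (Literature.Probability.RandomPlanarGeometry.SAW.HV.midWalks (Literature.Probability.RandomPlanarGeometry.SAW.HV.stripV (9 * L + 1) (9 * L + 1))).filter (fun P => Literature.Probability.RandomPlanarGeometry.SAW.HV.finalDart P = ((d, 0, false), (d, -1, true)) ∨ Literature.Probability.RandomPlanarGeometry.SAW.HV.finalDart P = ((d, -1, true), (d, 0, false))), Literature.Probability.RandomPlanarGeometry.SAW.hexCriticalFugacity ^ Literature.Probability.RandomPlanarGeometry.SAW.HV.mwLen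 P := by
  intro L
  have h0 : 0 ≤ hexCriticalFugacity := hexCriticalFugacity_pos_lt_one.1.le
  have hmapV : ∀ x ∈ stripV (9 * L + 1) (9 * L + 1), reflT x ∈ stripV (9 * L + 1) (9 * L + 1) :=
    fun x hx => (arcsWin_reflT_mem_stripV_iff x).2 hx
  rw [arcsWin_sum_coded_eq_sum_biUnion]
  have key := HV.sum_le_sum_of_injOn_of_nonneg (s := arcsIn (9 * L + 1) (9 * L + 1) L)
    (t := (Icc ((L : ℤ) + 1) (9 * (L : ℤ) + 1)).biUnion fun d =>
      (midWalks (stripV (9 * L + 1) (9 * L + 1))).filter fun P =>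
        finalDart P = ((d, 0, false), (d, -1, true)) ∨ finalDart P = ((d, -1, true), (d, 0, false)))
    (fun P : List HV => P.map reflT) (List.map_injective_iff.2 reflT.injective).injOn ?_
    (fun P => hexCriticalFugacity ^ mwLen P) (fun _ _ => pow_nonneg h0 _)
  · simpa only [mwLen_map] using key
  · intro Q hQ
    rw [arcsIn, mem_filter, mem_midWalks_iff] at hQ
    obtain ⟨hW, hα, h1, h2⟩ := hQ
    rw [mem_biUnion]
    refine ⟨-(finalDart Q).1.1, ?_, ?_⟩
    · rw [mem_Icc]; omega
    · rw [mem_filter, mem_midWalks_iff]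
      refine ⟨hW.map_iso reflT reflT_wOut reflT_hvOrigin hmapV, Or.inl ?_⟩
      rw [finalDart_map_iso reflT reflT_wOut]
      exact arcsWin_reflT_dart_of_isAlphaDart hα

end Summit.CriticalPhenomena.SAWScalingLimit.Theorems.HexConjecture.RootLocality

end
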